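import Mathlib
import HarnessLib
import Literature.Geometry.DiscreteGeometry.TammesThirteen

/-!
# Facet caps of the twelve link directions are small (from Tammes-13)

Route `PricedLinkCensus`, item `SoftFourRings` (stmt-AtomisticToContinuum-14234), evidence
`softrings-search.md` §12.  In the tree's face theory of spherical subdivisions
(`Literature.Geometry.DiscreteGeometry.ConvexHullFacets`, `SphericalCodeHullEuler*`) a facet of
`conv X` is recorded by a functional `c` with `⟪c, y⟫ ≤ 1` on `X` and `= 1` on the facet's vertices;
its vertices lie on the circle of angular radius `R = arccos (1/‖c‖)` about `c/‖c‖`, and the open cap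
inside it contains no point of `X`.  For twelve (or more) unit vectors with pairwise chordal distances
`≥ 0.957` — the link directions are pairwise `≥ 59.35°` apart, chord `≥ 0.99` — every such cap has
`cos R > 1 − 0.957²/2 ≈ 0.542`, i.e. `R < 57.18°` and `‖c‖ < 2/(2 − 0.957²) ≈ 1.845`
(`norm_lt_of_forall_inner_le_one`): otherwise the cap centre would be a thirteenth point at chordal
distance `≥ 0.957` from all of `X`, against Tammes' problem for `N = 13` (tree NAMED FACT
`musinTarasov2012_tammes_thirteen`; results using it are CONDITIONAL on it).  Unconditionally, two
tight points of one supporting functional are at inner product `≥ 2/‖c‖² − 1` (`= cos 2R`,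
`inner_ge_of_tight`, Cauchy–Schwarz), so under Tammes-13 every hull edge of the twelve directions is
shorter than `114.4°` (`inner_gt_of_tight_of_twelve_le_card`).
-/

namespace Summit.AtomisticToContinuum.Crystallization.Theorems

open Real RealInnerProductSpace Literature.Geometry.DiscreteGeometry

/-- **Two tight points of a supporting functional are at angle `≤ 2R`**: if `‖y‖ = ‖y'‖ = 1` and
`⟪c, y⟫ = ⟪c, y'⟫ = 1` with `c ≠ 0` then `2/‖c‖² − 1 ≤ ⟪y, y'⟫` (Cauchy–Schwarz on
`⟪c, y + y'⟫ = 2`). [folklore] -/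
theorem inner_ge_of_tight {y y' c : EuclideanSpace ℝ (Fin 3)} (hy : ‖y‖ = 1) (hy' : ‖y'‖ = 1)
    (hc : c ≠ 0) (hcy : ⟪c, y⟫ = 1) (hcy' : ⟪c, y'⟫ = 1) : 2 / ‖c‖ ^ 2 - 1 ≤ ⟪y, y'⟫ := by
  have hcn : 0 < ‖c‖ := norm_pos_iff.2 hc
  have h2 : ⟪c, y + y'⟫ = 2 := by rw [inner_add_right, hcy, hcy']; norm_num
  have hcs : (2 : ℝ) ≤ ‖c‖ * ‖y + y'‖ := h2 ▸ real_inner_le_norm c (y + y')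
  have hsq : ‖y + y'‖ ^ 2 = 2 + 2 * ⟪y, y'⟫ := by
    rw [← real_inner_self_eq_norm_sq, inner_add_left, inner_add_right, inner_add_right,
      real_inner_self_eq_norm_sq, real_inner_self_eq_norm_sq, hy, hy', real_inner_comm y y']
    ring
  have h4 : (4 : ℝ) ≤ ‖c‖ ^ 2 * (2 + 2 * ⟪y, y'⟫) := by
    rw [← hsq, ← mul_pow]; nlinarith [hcs, mul_nonneg hcn.le (norm_nonneg (y + y'))]
  have hc2 : 0 < ‖c‖ ^ 2 := by positivity
  rw [div_sub_one hc2.ne', div_le_iff₀ hc2]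
  nlinarith [h4]

/-- **Supporting functionals of twelve well-separated directions are short** (conditional on
Tammes-13): if `X` has at least twelve unit vectors with pairwise chordal distances `≥ 0.957` and
`⟪c, y⟫ ≤ 1` for all `y ∈ X`, then `‖c‖ < 2/(2 − 0.957²)`; for a facet or edge normal `c`
(`1/‖c‖ = cos R`, `R` the angular radius of its empty circumscribed cap) this is `R < 57.18°`.
Otherwise `c/‖c‖` is a thirteenth point at chordal distance `≥ 0.957` from `X`.
[cite: MusinTarasov2012, Theorem 1] -/
theorem norm_lt_of_forall_inner_le_one (hT : musinTarasov2012_tammes_thirteen)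
    {X : Finset (EuclideanSpace ℝ (Fin 3))} (hX1 : ∀ y ∈ X, ‖y‖ = 1) (hcard : 12 ≤ X.card)
    (hsep : ∀ u ∈ X, ∀ v ∈ X, u ≠ v → (0.957 : ℝ) ≤ dist u v) {c : EuclideanSpace ℝ (Fin 3)}
    (hc : ∀ y ∈ X, ⟪c, y⟫ ≤ 1) : ‖c‖ < 2 / (2 - 0.957 ^ 2) := by
  classical
  by_contra hge
  push Not at hge
  have hK : (1 : ℝ) < 2 / (2 - 0.957 ^ 2) := by norm_num
  have hcn : 0 < ‖c‖ := by linarith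
  have hc0 : c ≠ 0 := norm_pos_iff.1 hcn
  set p : EuclideanSpace ℝ (Fin 3) := ‖c‖⁻¹ • c with hp
  have hp1 : ‖p‖ = 1 := by
    rw [hp, norm_smul, norm_inv, norm_norm, inv_mul_cancel₀ hcn.ne']
  have hpy : ∀ y ∈ X, ⟪p, y⟫ ≤ ‖c‖⁻¹ := by
    intro y hy
    rw [hp, real_inner_smul_left]
    calc ‖c‖⁻¹ * ⟪c, y⟫ ≤ ‖c‖⁻¹ * 1 :=
          mul_le_mul_of_nonneg_left (hc y hy) (inv_nonneg.2 hcn.le)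
      _ = ‖c‖⁻¹ := mul_one _
  have hinv : ‖c‖⁻¹ ≤ (2 - 0.957 ^ 2) / 2 := by
    rw [inv_le_comm₀ hcn (by norm_num), inv_div]; exact hge
  have hpX : p ∉ X := by
    intro hpX'
    have h1 := hpy p hpX'
    rw [real_inner_self_eq_norm_sq, hp1] at h1
    norm_num at h1
    linarith
  have hdist : ∀ y ∈ X, (0.957 : ℝ) ≤ dist p y := by
    intro y hy
    have hd : dist p y ^ 2 = 2 - 2 * ⟪p, y⟫ := by
      rw [dist_eq_norm, ← real_inner_self_eq_norm_sq, inner_sub_left, inner_sub_right,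
        inner_sub_right, real_inner_self_eq_norm_sq, real_inner_self_eq_norm_sq, hp1, hX1 y hy,
        real_inner_comm p y]
      ring
    have h2 : (0.957 : ℝ) ^ 2 ≤ dist p y ^ 2 := by
      rw [hd]; linarith [hpy y hy]
    exact (pow_le_pow_iff_left₀ (by norm_num) dist_nonneg two_ne_zero).1 h2
  have hcard' : (insert p X).card = X.card + 1 := Finset.card_insert_of_notMem hpX
  have hle := hT (insert p X) (fun y hy => by
      rcases Finset.mem_insert.1 hy with rfl | hy
      · exact hp1
      · exact hX1 y hy)
    (fun a ha b hb hab => by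
      rcases Finset.mem_insert.1 ha with rfl | ha <;> rcases Finset.mem_insert.1 hb with rfl | hb
      · exact absurd rfl hab
      · exact hdist b hb
      · rw [dist_comm]; exact hdist a ha
      · exact hsep a ha b hb hab)
  omega

/-- **Hull edges and facet diagonals of the twelve directions are shorter than `114.4°`**
(conditional on Tammes-13): two tight points `y ≠ y'` of a supporting functional `c` of `X`
(`⟪c, ·⟫ ≤ 1` on `X`, `= 1` at `y, y'`) have `⟪y, y'⟫ > 2·((2 − 0.957²)/2)² − 1 ≈ −0.4123`.
[cite: MusinTarasov2012, Theorem 1] -/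
theorem inner_gt_of_tight_of_twelve_le_card (hT : musinTarasov2012_tammes_thirteen)
    {X : Finset (EuclideanSpace ℝ (Fin 3))} (hX1 : ∀ y ∈ X, ‖y‖ = 1) (hcard : 12 ≤ X.card)
    (hsep : ∀ u ∈ X, ∀ v ∈ X, u ≠ v → (0.957 : ℝ) ≤ dist u v) {c : EuclideanSpace ℝ (Fin 3)}
    (hc : ∀ y ∈ X, ⟪c, y⟫ ≤ 1) {y y' : EuclideanSpace ℝ (Fin 3)} (hy : y ∈ X) (hy' : y' ∈ X)
    (hcy : ⟪c, y⟫ = 1) (hcy' : ⟪c, y'⟫ = 1) :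
    2 * ((2 - 0.957 ^ 2) / 2) ^ 2 - 1 < ⟪y, y'⟫ := by
  have hlt := norm_lt_of_forall_inner_le_one hT hX1 hcard hsep hc
  have hc0 : c ≠ 0 := by
    rintro rfl
    rw [inner_zero_left] at hcy
    exact zero_ne_one hcy
  have hcn : 0 < ‖c‖ := norm_pos_iff.2 hc0
  have hge := inner_ge_of_tight (hX1 y hy) (hX1 y' hy') hc0 hcy hcy'
  have hK0 : (0 : ℝ) < 2 / (2 - 0.957 ^ 2) := by norm_num
  have hsq : ‖c‖ ^ 2 < (2 / (2 - 0.957 ^ 2)) ^ 2 := by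
    exact pow_lt_pow_left₀ hlt hcn.le two_ne_zero
  have h2 : 2 / (2 / (2 - 0.957 ^ 2)) ^ 2 < 2 / ‖c‖ ^ 2 :=
    div_lt_div_of_pos_left (by norm_num) (by positivity) hsq
  have h3 : (2 : ℝ) / (2 / (2 - 0.957 ^ 2)) ^ 2 = 2 * ((2 - 0.957 ^ 2) / 2) ^ 2 := by norm_num
  linarith

end Summit.AtomisticToContinuum.Crystallization.Theorems
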